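import Literature.MathematicalPhysics.QuantumFieldTheory.Balaban1983to89.B8SockP5uEAssemblyB
import Literature.MathematicalPhysics.QuantumFieldTheory.Balaban1983to89.B8Prop5UniqSectEWSrc
import Literature.MathematicalPhysics.QuantumFieldTheory.Balaban1983to89.B8Prop5SocketDatumSrc

/-!
# `Balaban1983to89.B8SockP5uEAssemblyBSrc` — [Balaban1985RegularSpaces] Proposition 5's UNIQUENESS clause (1.109) assembled for Theorem 4's ∕ Theorem 8's datum AT THE
# SOURCED GAUGE CONDITION (1.146): `B8SockP5uEAssemblyB.sockP5uE_body_of_join_b` re-run on `B8Prop5UniqSectEWSrc` — the body of the N05 knit's sourced socket `SP5u`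

statement-level skeleton of published theorems with citation tags; proofs where landed; nothing here is a claim about the Yang–Mills mass gap

T. Bałaban, *Spaces of regular gauge field configurations on a lattice and gauge fixing conditions*, Commun. Math. Phys. **99** (1985) 75–102
`[Balaban1985RegularSpaces]` ("B8"): Prop. 5 (1.109) p. 94, Thm 4 p. 88, (1.67)–(1.69) p. 88, Thm 8 (1.146) p. 101; [4] = [Balaban1985BackgroundPropagators] Thms 3.1, 3.3.

## WHY THIS FILE (cell `pub-ymgap`, HUMAN RULING D-0062; R134 seat `pub-ymgap-dag-n05-d` g5, DAG node N05 = [B8]; count-neutral)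

Eighth brick of the sourced Proposition-5 providers: the socket assembly of the UNIQUENESS side.  With `B8SockHFPRDSrc` (existence bodies for `SP5base`∕`SP5`) and this file
(`SP5u` body) every sourced Prop-5 socket of the N05 T8 knit has its ∃λ-∕uniqueness BODY in the tree at one member, from [4]'s letters, the sourced b9 lines at the datum, and a
Hermitian source of finite norm.  What REMAINS (after seat n05-c's carrier∕socket repair ρ1∕ρ2 fixes the exact admissibility text of the sockets): the thresholds∕windows WRAPPERS
producing the knit's `SP5base`∕`SP5`∕`SP5u` binders at the law members (patterns `B8SockHFPRD` §§4–6, `B8SockP5uEAssemblyB` §§2–3 with `mE ↦ mE + m_f∕2` in the window lemmas),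
reading the knit's `LanF (m)` as the multiplier form of (1.146) (n05-c g5's reading (b)) and `SH59m`∕`SH59k` from `SH59src`.

HONEST SCOPE.  Assembly by name; nothing of [4], Sect. E or Proposition 5 beyond the composition is asserted; the letters, the sourced b9 lines and the windows are displayed
hypotheses.  Count-neutral; N05 NOT discharged; one finite `T⁴` programme at fixed `ε`, Bałaban as printed — nothing continuum ∕ ℝ⁴ ∕ OS ∕ mass-gap ∕ Clay.  No `sorry`, no
definition.  Unit `pub-ymgap-dag-n05-d` (g5), 2026-08-27.

[cite: Balaban1985RegularSpaces, Prop. 5 (1.109) p.94, Thm 4 p.88, (1.67)–(1.69) p.88, Thm 8 (1.146) p.101; Balaban1985BackgroundPropagators, Thm 3.1 p.397, Thm 3.3 p.398]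
-/

noncomputable section

open NormedSpace

namespace Literature.MathematicalPhysics.QuantumFieldTheory.Balaban1983to89.B8SockP5uEAssemblyBSrc

open Complex (I)
open B7Prop1Explicit B7Prop2Explicit B7Prop1Local B7Eq92Concrete
open B7Prop2Explicit (C0 c2')
open B7Prop3Flat (c3)
open B7Prop10General (C6 C4G)
open B7Prop9Flat (C5')
open B7Eq78Linearization (conjR zdBlocking QprimeIter)
open B7Eq167Flat (InLambda)
open B8Ineq132 (covDerivFwd covDeriv InAk norm_conjR)
open B8Eq119TwistedAxial (Restr129 InAx bgT)
open B8Eq184Proof (gaugeExp cfgExp)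
open B8Eq182Proof (gAd)
open B8Eq188Proof (frakF3)
open B8Lemma1NonAbelian (mulCfg)
open B8Eq140Level (SideTouches sideTouches_mono)
open B8Eq146AExpansion (iEta expCfg)
open B8Ineq130 (tlo thi)
open B8Thm2LogB (blockTop)
open B8Eq138LandauZd (IsLandau138W covDivB covLap QT logCfg)
open B8Ineq125Concrete (C2p)
open B8Eq1117Concrete (XSpace)
open B8Eq1117KLevel (glev_on_towers_of_axial)
open B8SectEInLambdaWitness (witness_unitary_of_glev)
open B8Prop3GaugeFixedKLevel (expCfg_iEta_eq_cfgExp logField_spec mem_unitaryUnits_of_mgauge_eq)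
open B8Eq155JBound (expCfg_iEta_mem_unitaryUnits)
open B8Thm4AtLandau138 (mgauge_mgauge_inv)
open B8Thm4Concrete (mulCfg_eq_mul)
open B8LeafModelZd3 (SockB9P3)
open B8Prop5ContractionKLevel (Bd2 Mc Kc)
open B8LambdaSpaceKLevel (wt wt_nonneg)
open B8Prop5GaugeParamKLevel (norm_covDeriv_eq)
open B8Prop5KLevelLetters (covDivB_logCfg_gaugeFixed)
open B8Prop5SocketDatumSrc (grad_bound_of_datum_src)
open B8Prop5SocketDatum (exists_masked_datum grad_bound_of_datum bd2_covDivB_of_grad sideTouches_pair_of_mem sideTouches_of_tower_bond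
  h33_of_inAk hP_of_datum h69_of_datum hA_of_datum)
open B8Prop5UniqSectEWSrc (hFP_unique_of_sectE_local_wb_src)

-- `Site` alone could resolve to the torus sites of `Setup.lean`; re-export the `ℤ^d` sites of `B7Prop1Explicit`.
export B7Prop1Explicit (Site)

variable {d : ℕ} {𝔸 : Type*} [CStarAlgebra 𝔸] [Nontrivial 𝔸]

/-! ## §1 The provider body of the repaired uniqueness socket at one datum, guarded left inverse, radius `α₄` free -/

open B8Eq155JBound (Jcur wsup)
open B7Prop4GeneralLevels (linCovIter)
open B8ScaledSupNorm (bondNorm msup)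

/-- ★ **PROPOSITION 5's UNIQUENESS CLAUSE (1.109) FOR THEOREM 4's ∕ THEOREM 8's DATUM, AT THE SOURCED GAUGE CONDITION — the body of the N05 knit's sourced socket `SP5u` at one
member with `Ω₀ = ℤᵈ`.**  `B8SockP5uEAssemblyB.sockP5uE_body_of_join_b` VERBATIM except: (i) the datum's gauge condition is an ABSTRACT `Lan k (U′^{u₁⁻¹})`; (ii) the b9 input is
the SOURCED one at the datum (`SH59k`: the two (1.59)-lines with source terms `Sa`, `Sg` for every masked exponent — what the knit's `SH59src` delivers), whence
`|D*A′|₍₋₂₎ ≤ d·L²·(c⋆ + 2Sg) ≤ c_{DA}` (`B8Prop5SocketDatumSrc.grad_bound_of_datum_src`); (iii) a SOURCE `f` (finite `|f|₍₋₂₎`), the JOIN's windows read at `hE₂ + m_f∕2`;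
(iv) each competitor's gauge-fixed field obeys THE MULTIPLIER FORM OF (1.146) (`Δ↾Ω₀[D*(1∕iη log W) − f] = Q′ᵀμ`) instead of (1.38).  CONCLUSION unchanged: the two
competitors coincide, `v = w`.  Engine: `B8Prop5UniqSectEWSrc.hFP_unique_of_sectE_local_wb_src`; the competitors' clauses are carried to the engine's by the D*-identity
`covDivB_logCfg_gaugeFixed` (the source term rides along).
[cite: Balaban1985RegularSpaces, Prop. 5 (1.109) p.94, Thm 4 p.88 (uniqueness paragraph), Thm 8 (1.146) p.101 («exactly one gauge transformation u»), (1.67)–(1.69) p.88; Balaban1985BackgroundPropagators, Thm 3.1 p.397, Thm 3.3 p.398] -/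
theorem sockP5uE_body_of_join_b_src (hd2 : 2 ≤ d) {L : ℕ} (hL : 2 ≤ L) {η : ℝ} (hη : 0 < η) {k : ℕ} (hk : 1 ≤ k)
    -- the member's geometry (`Ω 0 = univ` sub-family)
    {Ω : ℕ → Set (Site d)} (hΩ : ∀ j, Ω (j + 1) ⊆ Ω j) (hΩ0 : Ω 0 = Set.univ) {Λs : ℕ → ℕ → Set (Site d)} {Λb : ℕ → ℕ → Set (Site d × Fin d)}
    (hbox : ∀ m, m ≤ k → ∀ j, j ≤ m → ∀ c ∈ Λb m j, ∀ x, InBox (loK L j c.1) (bondHiK L j c.1 c.2) x → x ∈ Ω j)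
    (hclass : ∀ m, m ≤ k → ∀ j, j ≤ m → ∀ c ∈ Λb m j,
      (c.1 ∈ Λs m j ∧ c.1 + e c.2 ∈ Λs m j) ∨
      (∃ j', j = j' + 1 ∧ (∀ x, (L : ℤ) • c.1 ≤ x → x ≤ (L : ℤ) • c.1 + blockTop L → x ∈ Λs m j') ∧ c.1 + e c.2 ∈ Λs m j) ∨
      (∃ j', j = j' + 1 ∧ c.1 ∈ Λs m j ∧ (∀ x, (L : ℤ) • (c.1 + e c.2) ≤ x → x ≤ (L : ℤ) • (c.1 + e c.2) + blockTop L → x ∈ Λs m j')))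
    (htower : ∀ j, j ≤ k → ∀ y ∈ Λs k j, ∀ x, InBox (tlo L y j) (thi L y j) x → x ∈ Ω j)
    -- the socket's antecedents: constants, (1.33), (1.34), (1.35)
    {α₀ α₁ B₀ cs α₄ cu : ℝ} (hα₀ : 0 < α₀) (hα₁ : 0 < α₁) (hB₀ : 0 < B₀)
    (hcs : cs = 5 * (d : ℝ) * L * B₀ * (α₀ + α₁)) (hα₄ : 0 < α₄)
    {U₀ U' : Site d → Fin d → 𝔸ˣ} (hU₀ : ∀ x κ, U₀ x κ ∈ unitaryUnits 𝔸) (hU' : ∀ x κ, U' x κ ∈ unitaryUnits 𝔸)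
    (h33 : InAk L k η α₀ Ω U₀) (h34 : InAk L k η α₀ Ω (mulCfg U' U₀)) (hAx : ∀ m', m' ≤ k → InAx L m' (Λs m') U₀ (mulCfg U' U₀))
    (h135 : ∀ j, j ≤ k → ∀ (z : Site d) (μ : Fin d), (∀ x, InBox (loK L j z) (bondHiK L j z μ) x → x ∈ Ω j) →
      ‖(avgIter L (mulCfg U' U₀) j z μ : 𝔸) - (avgIter L U₀ j z μ : 𝔸)‖ ≤ α₁)
    -- the datum of Theorem 4's uniqueness paragraph: `u₁` with (1.29), (1.38) and the (1.62)-shape for `U₁ = U′^{u₁⁻¹}`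
    {u₁ : Site d → 𝔸ˣ} (hu₁ : ∀ x, u₁ x ∈ unitaryUnits 𝔸) (h129 : Restr129 L k (Λs k) U₀ u₁)
    (Lan : ℕ → (Site d → Fin d → 𝔸ˣ) → Prop) (hLan : Lan k (mgauge U₀ u₁⁻¹ U'))
    (hdat : ∃ A₁ : Site d → Fin d → 𝔸, ∀ j, j ≤ k → ∀ (x : Site d) (κ : Fin d), SideTouches (Ω j) x κ →
      mgauge U₀ u₁⁻¹ U' x κ = cfgExp η A₁ x κ ∧ ‖A₁ x κ‖ ≤ cs * ((L : ℝ) ^ j * η)⁻¹)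
    -- THE SOURCED b9 INPUT AT THE DATUM, TOP LEVEL `k` (the two (1.59)-lines with source terms `Sa`, `Sg` for every masked exponent of `U′^{u₁⁻¹}` —
    -- what the knit's `SH59src` delivers at `(k, u₁, U′^{u₁⁻¹})`), and THE SOURCE `f`
    {Sa Sg : ℝ} (hSg : 0 ≤ Sg)
    (SH59k : ∀ A' : Site d → Fin d → 𝔸, (∀ y τ, IsSelfAdjoint (A' y τ)) →
      (∀ j, j ≤ k → ∀ (y : Site d) (τ : Fin d), SideTouches (Ω j) y τ →
        mgauge U₀ u₁⁻¹ U' y τ = cfgExp η A' y τ ∧ ‖A' y τ‖ ≤ cs * ((L : ℝ) ^ j * η)⁻¹) →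
      (∀ (y : Site d) (τ : Fin d), (∀ j, j ≤ k → ¬ SideTouches (Ω j) y τ) → A' y τ = 0) →
      msup L k η (-(1 : ℝ)) (fun j (b : Site d × Fin d) => SideTouches (Ω j) b.1 b.2) (fun b => A' b.1 b.2)
          ≤ B₀ * (bondNorm L k η (-(3 : ℝ)) Ω (fun x μ => Jcur η U₀ A' μ x)
          + wsup 1 (fun p : {p : ℕ × (Site d × Fin d) // p.1 ≤ k ∧ p.2 ∈ Λb k p.1} =>
          linCovIter L U₀ (iEta η A') p.1.1 p.1.2.1 p.1.2.2)) + Sa ∧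
        msup L k η (-(2 : ℝ)) (fun j (t : Fin d × Fin d × Site d) => SideTouches (Ω j) t.2.2 t.2.1)
          (fun t => covDerivFwd η U₀ t.1 (fun z => A' z t.2.1) t.2.2)
          ≤ B₀ * (bondNorm L k η (-(3 : ℝ)) Ω (fun x μ => Jcur η U₀ A' μ x)
          + wsup 1 (fun p : {p : ℕ × (Site d × Fin d) // p.1 ≤ k ∧ p.2 ∈ Λb k p.1} =>
          linCovIter L U₀ (iEta η A') p.1.1 p.1.2.1 p.1.2.2)) + Sg)
    {f : Site d → 𝔸} {mf : ℝ} (hmf : 0 ≤ mf) (hf : Bd2 L η k Ω f mf)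
    -- Proposition 3's windows at `(α₀, α₂ := c⋆)` not implied by the JOIN's
    {C₂ : ℝ} (hside : 36 * d * B₀ * cs ≤ 1 / 2)
    (hC₂ : 8 * (131072 * ((d : ℝ) + 1) ^ 2) * Real.exp (4 * (800 * ((d : ℝ) + 1) ^ 2 * ((d : ℝ) + 4)) * α₀) ≤ C₂)
    (h61 : 2 * cs ^ 2 + 20 * d * α₀ * cs + 2 * C₂ * cs ^ 2 ≤ α₀ + α₁) (hsmall₁ : (d : ℝ) * L * α₁ ≤ 1 / 8)
    -- the [4] LETTERS at `(k, U₀)`, with the uniqueness laws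
    (g Δ : (Site d → 𝔸) →ₗ[ℂ] (Site d → 𝔸)) (q : (Site d → 𝔸) →ₗ[ℂ] (ℕ → Site d → 𝔸)) (qs : (ℕ → Site d → 𝔸) →ₗ[ℂ] (Site d → 𝔸))
    (Aw c : (ℕ → Site d → 𝔸) →ₗ[ℂ] (ℕ → Site d → 𝔸))
    (g_leftB : ∀ x : Site d → 𝔸, (∃ C : ℝ, ∀ y, ‖x y‖ ≤ C) → g (Δ x + qs (Aw (q x))) = x)
    (c_left' : ∀ φ, qs (c (q (g (g (qs φ))))) = qs φ)
    (hΔ : ∀ (f : Site d → 𝔸), ∀ x ∈ Ω 0, Δ f x = covLap η U₀ ((Ω 0).indicator f) x)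
    (hqs : ∀ (μ : ℕ → Site d → 𝔸), ∀ x ∈ Ω 0, qs μ x = QT L k (Λs k) U₀ μ x)
    (hq : ∀ (f : Site d → 𝔸) (j : ℕ), j ≤ k → ∀ y ∈ Λs k j, q f j y = QprimeIter (zdBlocking d L) (bgT L U₀) j f y)
    (hq0 : ∀ (f : Site d → 𝔸) (j : ℕ) (y : Site d), ¬ (j ≤ k ∧ y ∈ Λs k j) → q f j y = 0)
    (H' : XSpace d k 𝔸 →ₗ[ℂ] (Site d → 𝔸)) {B₀'H B₂' BG BR : ℝ} (hB₀'H : 0 < B₀'H) (hB₂' : 0 ≤ B₂') (hBG : 0 ≤ BG) (hBR : 0 ≤ BR)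
    (hH0 : ∀ (X : XSpace d k 𝔸) (x : Site d), ‖H' X x‖ ≤ B₀'H * ‖X‖)
    (hH1 : ∀ j, j ≤ k → ∀ (X : XSpace d k 𝔸), ∀ p ∈ {b : Site d × Fin d | SideTouches (Ω j) b.1 b.2},
      wt L η j * ‖covDerivFwd η U₀ p.2 (H' X) p.1‖ ≤ B₀'H * ‖X‖)
    (hH2 : ∀ X : XSpace d k 𝔸, Bd2 L η k Ω (covLap η U₀ (H' X)) (B₂' * ‖X‖))
    (hQH : ∀ (Y : XSpace d k 𝔸) (j : ℕ) (hj : j ≤ k) (y : Site d), y ∈ Λs k j →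
      QprimeIter (zdBlocking d L) (bgT L U₀) j (H' Y) y = Y (⟨j, Nat.lt_succ_of_le hj⟩, y))
    (hG : ∀ (f : Site d → 𝔸) (r : ℝ), 0 ≤ r → Bd2 L η k Ω f r →
      (∀ x, ‖g f x‖ ≤ BG * r) ∧ ∀ j, j ≤ k → ∀ p ∈ {b : Site d × Fin d | SideTouches (Ω j) b.1 b.2},
        wt L η j * ‖covDerivFwd η U₀ p.2 (g f) p.1‖ ≤ BG * r)
    (hRbd : ∀ (f : Site d → 𝔸) (r : ℝ), 0 ≤ r → Bd2 L η k Ω f r → Bd2 L η k Ω (f - g (qs (c (q (g f))))) (BR * r))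
    -- the JOIN's scalar windows, one-for-one (`αP := α₀`, `α₄` free; `cB cA cDA` free above their datum values)
    {cB cA cDA : ℝ} (hcBlo : L * cs ≤ cB) (hcAlo : L * cs ≤ cA) (hcDAlo : (d : ℝ) * (L : ℝ) ^ 2 * (cs + 2 * Sg) ≤ cDA)
    (hα3 : C0 d * α₀ ≤ 1 / 3) (hα4 : 4 * α₀ ≤ c2' d L)
    (hsmall : Real.exp (4 * (800 * ((d : ℝ) + 1) ^ 2 * ((d : ℝ) + 4)) * α₀) * (1 + 8 * (131072 * ((d : ℝ) + 1) ^ 2) * cB) ≤ 2)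
    (hc₃ : 2 * cB ≤ c3 d L) (hsc : 2048 * (d : ℝ) * cB ≤ 1) (hα₃' : 40 * d * cB ≤ 1 / 200)
    (hs₁ : 200 * C6 d * (2 * α₄) ≤ 1) (hs₂ : 12000 * ((d : ℝ) + 1) * L * (2 * α₄) ≤ 1)
    (hs₃ : C4G d L * (α₀ + 40 * d * cB + 4 * (2 * α₄)) ≤ 1)
    (hs₄ : 1024 * ((d : ℝ) + 1) * ((d : ℝ) + 4) * L ^ 2 * α₀ ≤ 1) (hs₅ : 32 * ((d : ℝ) + 1) ^ 2 * C6 d * L ^ 2 * α₀ ≤ 1)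
    (hs₆ : 16 * d * C5' d * C6 d * (L : ℝ) ^ 2 * α₀ ≤ 1) (hs₇ : 8 * d * C6 d * L * α₀ ≤ 1)
    (hsm : 40 * d * cB + α₄ ≤ 1 / (4 * B₀'H * (2 * C2p d))) (hprod8 : 2 * C6 d * (40 * d * cB + 4 * α₄) ≤ 1 / 8)
    {hE hE₂ lE lE₂ : ℝ} (hE_def : hE = B₀'H * (C2p d * (40 * d * cB + α₄) * α₄)) (hE₂_def : hE₂ = B₂' * (C2p d * (40 * d * cB + α₄) * α₄))
    (lE_def : lE = B₀'H * (4 * C2p d * (40 * d * cB + 2 * α₄))) (lE₂_def : lE₂ = B₂' * (4 * C2p d * (40 * d * cB + 2 * α₄)))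
    (hcA' : cA ≤ 1 / 13) (ha₁' : α₄ / 4 + hE ≤ 1 / 24) (hb₁' : α₄ / 4 + hE ≤ 1 / 140) (hθ : 10 * (α₄ / 4 + hE) * BR ≤ 1 / 2)
    (h103 : BG * Mc d BR (α₄ / 4 + hE) cA (hE₂ + mf / 2) cDA ≤ α₄ / 4)
    (h106 : BG * Kc d BR (α₄ / 4 + hE) cA (hE₂ + mf / 2) cDA lE₂ (1 + lE) (1 + lE) ≤ 1 / 2)
    -- the two uniqueness windows: Lipschitz modulus of `H_c`, and the radius `c_u` of (1.109) against the ¼α₄-ball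
    (hlE : lE ≤ 1 / 2) (hcu : cu + hE ≤ α₄ / 4)
    -- the competitors
    {v w : Site d → 𝔸ˣ} {lam mu : Site d → 𝔸}
    (hv : ∀ x, ((gaugeExp lam x : 𝔸ˣ) : 𝔸) = ((v x : 𝔸ˣ) : 𝔸) ∧ IsSelfAdjoint (lam x) ∧ ‖lam x‖ < cu)
    (hvD : ∀ j, j ≤ k → ∀ b ∈ {b : Site d × Fin d | SideTouches (Ω j) b.1 b.2}, ((L : ℝ) ^ j * η) * ‖covDerivFwd η U₀ b.2 lam b.1‖ < cu)
    (hw : ∀ x, ((gaugeExp mu x : 𝔸ˣ) : 𝔸) = ((w x : 𝔸ˣ) : 𝔸) ∧ IsSelfAdjoint (mu x) ∧ ‖mu x‖ < cu)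
    (hwD : ∀ j, j ≤ k → ∀ b ∈ {b : Site d × Fin d | SideTouches (Ω j) b.1 b.2}, ((L : ℝ) ^ j * η) * ‖covDerivFwd η U₀ b.2 mu b.1‖ < cu)
    -- each competitor's gauge-fixed field obeys THE MULTIPLIER FORM OF (1.146) at `k` levels (`B8Eq138LandauZd.IsLandau146`'s second clause) and (1.29)
    (hLv : ∃ μ : ℕ → Site d → 𝔸, ∀ x ∈ Ω 0,
      covLap η U₀ ((Ω 0).indicator fun y => covDivB η U₀ (logCfg η (mgauge U₀ v⁻¹ (mgauge U₀ u₁⁻¹ U'))) y - f y) x = QT L k (Λs k) U₀ μ x)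
    (hRv : Restr129 L k (Λs k) U₀ (u₁ * v))
    (hLw : ∃ μ : ℕ → Site d → 𝔸, ∀ x ∈ Ω 0,
      covLap η U₀ ((Ω 0).indicator fun y => covDivB η U₀ (logCfg η (mgauge U₀ w⁻¹ (mgauge U₀ u₁⁻¹ U'))) y - f y) x = QT L k (Λs k) U₀ μ x)
    (hRw : Restr129 L k (Λs k) U₀ (u₁ * w)) :
    ∀ x, v x = w x := by
  subst hcs
  have hL1 : 1 ≤ L := le_trans (by norm_num) hL
  have hd1 : 1 ≤ d := le_trans (by norm_num) hd2
  have hLr : (1 : ℝ) ≤ L := by exact_mod_cast hL1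
  have hd0 : (1 : ℝ) ≤ d := by exact_mod_cast hd1
  have huniv : ∀ x, x ∈ Ω 0 := fun x => by rw [hΩ0]; exact Set.mem_univ x
  obtain ⟨k', rfl⟩ : ∃ k', k = k' + 1 := ⟨k - 1, (Nat.sub_add_cancel hk).symm⟩
  have hsum : 0 < α₀ + α₁ := add_pos hα₀ hα₁
  have hcs0 : 0 ≤ 5 * (d : ℝ) * L * B₀ * (α₀ + α₁) := by positivity
  have hcspos : 0 < 5 * (d : ℝ) * L * B₀ * (α₀ + α₁) := by positivity
  have hα₄pos : 0 < α₄ := hα₄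
  -- `c⋆ ≤ L·c⋆ ≤ cB`, hence Prop. 3's remaining windows from the JOIN's
  have hcsB : 5 * (d : ℝ) * L * B₀ * (α₀ + α₁) ≤ cB := (le_mul_of_one_le_left hcs0 hLr).trans hcBlo
  have hcB0 : 0 ≤ cB := hcs0.trans hcsB
  have hcA0 : 0 ≤ cA := (hcs0.trans (le_mul_of_one_le_left hcs0 hLr)).trans hcAlo
  have hcDA0 : 0 ≤ cDA := le_trans (by positivity) hcDAlo
  have hcBsmall : (d : ℝ) * cB ≤ 1 / 8000 := by linarith only [hα₃']
  have hdcs : (d : ℝ) * (5 * (d : ℝ) * L * B₀ * (α₀ + α₁)) ≤ 1 / 8000 :=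
    (mul_le_mul_of_nonneg_left hcsB (by positivity)).trans hcBsmall
  have hcs8000 : 5 * (d : ℝ) * L * B₀ * (α₀ + α₁) ≤ 1 / 8000 := (le_mul_of_one_le_left hcs0 hd0).trans hdcs
  have h16 : 16 * (5 * (d : ℝ) * L * B₀ * (α₀ + α₁)) ≤ 1 := by linarith only [hcs8000]
  have h50 : 50 * d * (5 * (d : ℝ) * L * B₀ * (α₀ + α₁)) ≤ 1 := by linarith only [hdcs]
  have hd5 : 5 * (5 * (d : ℝ) * L * B₀ * (α₀ + α₁)) * ((d : ℝ) - 1) ≤ 4 := by nlinarith only [hdcs, hcs0]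
  have hc₃3 : 2 * (5 * (d : ℝ) * L * B₀ * (α₀ + α₁)) ≤ c3 d L := by linarith only [hc₃, hcsB]
  have hsmall3 : Real.exp (4 * (800 * ((d : ℝ) + 1) ^ 2 * ((d : ℝ) + 4)) * α₀) *
      (1 + 8 * (131072 * ((d : ℝ) + 1) ^ 2) * (5 * (d : ℝ) * L * B₀ * (α₀ + α₁))) ≤ 2 := by
    refine le_trans (mul_le_mul_of_nonneg_left ?_ (Real.exp_pos _).le) hsmall
    have h := mul_le_mul_of_nonneg_left hcsB (show (0 : ℝ) ≤ 8 * (131072 * ((d : ℝ) + 1) ^ 2) by positivity)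
    linarith only [h]
  have hαP2 : 2 * α₀ ≤ c2' d L := by linarith only [hα4, hα₀]
  have hC2 : 0 ≤ C2p d := B8Ineq125Concrete.C2p_nonneg d
  have hhE : 0 ≤ hE := by rw [hE_def]; positivity
  -- the datum `U₁ = U′^{u₁⁻¹}`: unitary, `U₁^{u₁} = U′`, and its Hermitian logarithm on the touched bonds ((1.62)-shape ⇒ `logField_spec`)
  set U₁ : Site d → Fin d → 𝔸ˣ := mgauge U₀ u₁⁻¹ U' with hU₁def
  have hW : mgauge U₀ u₁ U₁ = U' := mgauge_mgauge_inv U₀ U' u₁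
  have hWu : ∀ x κ, U₁ x κ ∈ unitaryUnits 𝔸 := mem_unitaryUnits_of_mgauge_eq hU₀ hU' hu₁ hW
  obtain ⟨A₁, hA₁⟩ := hdat
  have hdat' : ∀ j, j ≤ k' + 1 → ∀ b ∈ {b : Site d × Fin d | SideTouches (Ω j) b.1 b.2},
      U₁ b.1 b.2 = cfgExp η (logCfg η U₁) b.1 b.2 ∧ IsSelfAdjoint (logCfg η U₁ b.1 b.2) ∧
        ‖logCfg η U₁ b.1 b.2‖ ≤ (5 * (d : ℝ) * L * B₀ * (α₀ + α₁)) * ((L : ℝ) ^ j * η)⁻¹ := by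
    intro j hj b hb
    obtain ⟨hexp, hbd⟩ := hA₁ j hj b.1 b.2 hb
    have hbd' : ‖A₁ b.1 b.2‖ ≤ (5 * (d : ℝ) * L * B₀ * (α₀ + α₁)) * η⁻¹ := by
      refine hbd.trans ?_
      have hLj : (1 : ℝ) ≤ (L : ℝ) ^ j := one_le_pow₀ hLr
      have : ((L : ℝ) ^ j * η)⁻¹ ≤ η⁻¹ := by
        rw [mul_inv]
        calc ((L : ℝ) ^ j)⁻¹ * η⁻¹ ≤ 1 * η⁻¹ := by gcongr; exact inv_le_one_of_one_le₀ hLj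
          _ = η⁻¹ := one_mul _
      exact mul_le_mul_of_nonneg_left this hcs0
    obtain ⟨hlogA, hsa, hWexp⟩ := logField_spec hη U₀ hWu hexp hbd' (by linarith only [h16])
    refine ⟨hWexp, ?_, ?_⟩
    · simpa [logCfg] using hsa
    · show ‖logCfg η U₁ b.1 b.2‖ ≤ _
      rw [logCfg, hlogA]
      exact hbd
  -- the MASKED exponent `A′` (globally Hermitian); at `Ω 0 = univ` every bond is touched, so `U₁ = e^{iηA′}` GLOBALLY
  obtain ⟨A', hsa, -, hWA, hA0⟩ := exists_masked_datum hdat'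
  have hWA1 : ∀ j, j ≤ k' → ∀ (y : Site d) (τ : Fin d), SideTouches (Ω j) y τ → U₁ y τ = cfgExp η A' y τ :=
    fun j hj y τ hs => (hWA j (Nat.le_succ_of_le hj) y τ hs).1
  have h41 : ∀ j, j ≤ k' → ∀ (y : Site d) (τ : Fin d), SideTouches (Ω j) y τ →
      ‖A' y τ‖ ≤ (5 * (d : ℝ) * L * B₀ * (α₀ + α₁)) * ((L : ℝ) ^ j * η)⁻¹ := fun j hj y τ hs => (hWA j (Nat.le_succ_of_le hj) y τ hs).2
  have htouch0 : ∀ (y : Site d) (τ : Fin d), SideTouches (Ω 0) y τ := fun y τ => (sideTouches_pair_of_mem hd2 (huniv y) τ).1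
  have hU₁eq : U₁ = cfgExp η A' := funext fun y => funext fun τ => (hWA 0 (Nat.zero_le _) y τ (htouch0 y τ)).1
  have hA'0 : ∀ (y : Site d) (τ : Fin d), ‖A' y τ‖ ≤ (5 * (d : ℝ) * L * B₀ * (α₀ + α₁)) * η⁻¹ := fun y τ => by
    have h := (hWA 0 (Nat.zero_le _) y τ (htouch0 y τ)).2
    rwa [pow_zero, one_mul] at h
  -- the JOIN's datum binders BY NAME (`B8Prop5SocketDatum` §7, §3–§4)
  have h33' := h33_of_inAk hL1 hα₀ h33 le_rfl htower
  have hP' := hP_of_datum hL1 hα₀ hΩ h34 le_rfl htower hu₁ hW hWA1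
  have h69' : ∀ j, j ≤ k' + 1 → ∀ y ∈ Λs (k' + 1) j, ∀ (x : Site d) (κ : Fin d), InBox (tlo L y j) (thi L y j) x →
      InBox (tlo L y j) (thi L y j) (x + e κ) → ‖iEta η A' x κ‖ ≤ cB * ((L : ℝ) ^ j)⁻¹ :=
    fun j hj y hy x κ hx hxe =>
      (h69_of_datum hd2 hL1 hη hΩ htower hcs0 h41 j hj y hy x κ hx hxe).trans (mul_le_mul_of_nonneg_right hcBlo (by positivity))
  have hAd : ∀ j, j ≤ k' + 1 → ∀ x ∈ Ω j, ∀ μ : Fin d,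
      wt L η j * ‖A' x μ‖ ≤ cA ∧ wt L η j * ‖conjR (U₀ (x - e μ) μ)⁻¹ (A' (x - e μ) μ)‖ ≤ cA := fun j hj x hx μ =>
    ⟨(hA_of_datum hd2 hL1 hη hΩ hU₀ hcs0 h41 j hj x hx μ).1.trans hcAlo, (hA_of_datum hd2 hL1 hη hΩ hU₀ hcs0 h41 j hj x hx μ).2.trans hcAlo⟩
  have hBu : ∀ (x : Site d) (κ : Fin d), expCfg (iEta η A') x κ ∈ unitaryUnits 𝔸 := expCfg_iEta_mem_unitaryUnits η hsa
  have hexpA : expCfg (iEta η A') = U₁ := by rw [expCfg_iEta_eq_cfgExp, hU₁eq]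
  have hAx' : InAx L (k' + 1) (Λs (k' + 1)) U₀ (mgauge U₀ u₁ (expCfg (iEta η A')) * U₀) := by
    rw [hexpA, hW, ← mulCfg_eq_mul]
    exact hAx (k' + 1) le_rfl
  -- the source `D*A′`: (1.69)'s gradient member by Prop. 3 at the top level (§3), then `|D*A′|₍₋₂₎ ≤ d·L²·c⋆ ≤ cDA` (§4)
  obtain ⟨h59a, h59g⟩ := SH59k A' hsa hWA hA0
  have hgrad := grad_bound_of_datum_src hd2 hη hL (k' + 1) hU₀ hU' hα₀ hα₁ hcspos hB₀.le hα3 hα4 h16 hd5 hsmall3 hc₃3 hside h50 hC₂ h61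
    hsmall₁ Ω hΩ Λs Λb hbox hclass h33 h34 hAx h135 hk le_rfl Lan hu₁ hW h129 hLan hsa hWA hA0 h59a h59g
  have hcsS : 0 ≤ 5 * (d : ℝ) * L * B₀ * (α₀ + α₁) + 2 * Sg := by positivity
  have hDA : Bd2 L η (k' + 1) Ω (fun y => covDivB η U₀ A' y) cDA := fun j hj x hx =>
    (bd2_covDivB_of_grad hd2 hL1 hη hΩ hU₀ hcsS (fun j hj y κ τ hs => hgrad j (Nat.le_succ_of_le hj) y κ τ hs) j hj x hx).trans hcDAlo
  -- the JOIN's bond classes `Eb j := {b ∣ SideTouches (Ω j) b}` (§6)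
  have hEbΩ : ∀ j, j ≤ k' + 1 → ∀ x ∈ Ω j, ∀ μ : Fin d, (x, μ) ∈ {b : Site d × Fin d | SideTouches (Ω j) b.1 b.2} ∧
      (x - e μ, μ) ∈ {b : Site d × Fin d | SideTouches (Ω j) b.1 b.2} := fun j _ x hx μ => sideTouches_pair_of_mem hd2 hx μ
  have hEbT : ∀ j, j ≤ k' + 1 → ∀ y ∈ Λs (k' + 1) j, ∀ (x : Site d) (κ : Fin d), InBox (tlo L y j) (thi L y j) x →
      InBox (tlo L y j) (thi L y j) (x + e κ) → (x, κ) ∈ {b : Site d × Fin d | SideTouches (Ω j) b.1 b.2} :=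
    fun j hj y hy x κ hx _ => sideTouches_of_tower_bond hd2 htower hj hy x κ hx
  -- each competitor: `v = e^{iλ}` globally; its (1.38) of record is the multiplier clause of `HFP` at `A′` by the D*-identity
  have hcu4 : cu ≤ α₄ / 4 := by linarith only [hcu, hhE]
  have hcu12 : cu ≤ 1 / 12 := by linarith only [hcu4, ha₁', hhE]
  have hcu70 : cu ≤ 1 / 70 := by linarith only [hcu4, hb₁', hhE]
  have hcomp : ∀ (vv : Site d → 𝔸ˣ) (ll : Site d → 𝔸),
      (∀ x, ((gaugeExp ll x : 𝔸ˣ) : 𝔸) = ((vv x : 𝔸ˣ) : 𝔸) ∧ IsSelfAdjoint (ll x) ∧ ‖ll x‖ < cu) →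
      (∀ j, j ≤ k' + 1 → ∀ b ∈ {b : Site d × Fin d | SideTouches (Ω j) b.1 b.2}, ((L : ℝ) ^ j * η) * ‖covDerivFwd η U₀ b.2 ll b.1‖ < cu) →
      (∃ μ : ℕ → Site d → 𝔸, ∀ x ∈ Ω 0,
        covLap η U₀ ((Ω 0).indicator fun y => covDivB η U₀ (logCfg η (mgauge U₀ vv⁻¹ (mgauge U₀ u₁⁻¹ U'))) y - f y) x =
          QT L (k' + 1) (Λs (k' + 1)) U₀ μ x) →
      vv = gaugeExp ll ∧ (∀ x, ‖ll x‖ ≤ cu) ∧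
      (∀ j, j ≤ k' + 1 → ∀ p ∈ {b : Site d × Fin d | SideTouches (Ω j) b.1 b.2}, wt L η j * ‖covDerivFwd η U₀ p.2 ll p.1‖ ≤ cu) ∧
      (∃ μ : ℕ → Site d → 𝔸, ∀ x ∈ Ω 0,
        covLap η U₀ ((Ω 0).indicator fun y => covDivB η U₀ A' y + covLap η U₀ ll y +
          ((conjR (gaugeExp ll y)⁻¹ (covDivB η U₀ A' y) - covDivB η U₀ A' y) +
            (gAd (covLap η U₀ ll y) (ll y) - covLap η U₀ ll y) + ∑ μ, frakF3 η U₀ ll A' y μ) - f y) x = QT L (k' + 1) (Λs (k' + 1)) U₀ μ x) := by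
    intro vv ll hll hllD hL146
    have hveq : vv = gaugeExp ll := funext fun x => (Units.ext (hll x).1).symm
    refine ⟨hveq, fun x => (hll x).2.2.le, fun j hj p hp => (hllD j hj p hp).le, ?_⟩
    -- the multiplier form of (1.146) for `U₁^{v⁻¹} = (e^{iηA′})^{(e^{iλ})⁻¹}`, rewritten by the D*-identity on `Ω₀` (the source term is untouched)
    have hL' : ∃ μ : ℕ → Site d → 𝔸, ∀ x ∈ Ω 0,
        covLap η U₀ ((Ω 0).indicator fun y => covDivB η U₀ (logCfg η (mgauge U₀ (gaugeExp ll)⁻¹ (cfgExp η A'))) y - f y) x =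
          QT L (k' + 1) (Λs (k' + 1)) U₀ μ x := by
      rw [← hveq, ← hU₁eq]; exact hL146
    obtain ⟨μ, hμ⟩ := hL'
    refine ⟨μ, fun x hx => ?_⟩
    have hind : ((Ω 0).indicator fun y => covDivB η U₀ A' y + covLap η U₀ ll y +
        ((conjR (gaugeExp ll y)⁻¹ (covDivB η U₀ A' y) - covDivB η U₀ A' y) +
          (gAd (covLap η U₀ ll y) (ll y) - covLap η U₀ ll y) + ∑ μ, frakF3 η U₀ ll A' y μ) - f y) =
        ((Ω 0).indicator fun y => covDivB η U₀ (logCfg η (mgauge U₀ (gaugeExp ll)⁻¹ (cfgExp η A'))) y - f y) := by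
      refine Set.indicator_congr fun y _ => ?_
      have hly : ‖ll y‖ ≤ 1 / 12 := (hll y).2.2.le.trans hcu12
      have hDy : ∀ ν : Fin d, η * ‖covDerivFwd η U₀ ν ll y‖ ≤ 1 / 70 := fun ν => by
        have h := (hllD 0 (Nat.zero_le _) (y, ν) (htouch0 y ν)).le
        rw [pow_zero, one_mul] at h
        exact h.trans hcu70
      have hay : ∀ ν : Fin d, η * ‖covDeriv η U₀ ν ll y‖ ≤ 1 / 70 := fun ν => by
        rw [norm_covDeriv_eq hU₀]
        have h := (hllD 0 (Nat.zero_le _) (y - e ν, ν) (htouch0 (y - e ν) ν)).le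
        rw [pow_zero, one_mul] at h
        exact h.trans hcu70
      have hYy : ∀ ν : Fin d, η * ‖conjR (U₀ (y - e ν) ν)⁻¹ (A' (y - e ν) ν)‖ ≤ 1 / 12 := fun ν => by
        have hu : ((U₀ (y - e ν) ν)⁻¹ : 𝔸ˣ) ∈ U1 𝔸 := (U1 𝔸).inv_mem (unitaryUnits_le_U1 (hU₀ _ ν))
        rw [norm_conjR hu]
        calc η * ‖A' (y - e ν) ν‖ ≤ η * ((5 * (d : ℝ) * L * B₀ * (α₀ + α₁)) * η⁻¹) := mul_le_mul_of_nonneg_left (hA'0 _ ν) hη.le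
          _ = 5 * (d : ℝ) * L * B₀ * (α₀ + α₁) := by field_simp
          _ ≤ 1 / 12 := by linarith only [h16]
      rw [(covDivB_logCfg_gaugeFixed hη U₀ A' hly hDy hay hYy).symm]
    rw [hind]
    exact hμ x hx
  obtain ⟨hveq, hl₁, hD₁, hmult₁⟩ := hcomp v lam hv hvD hLv
  obtain ⟨hweq, hl₂, hD₂, hmult₂⟩ := hcomp w mu hw hwD hLw
  have hR₁ : Restr129 L (k' + 1) (Λs (k' + 1)) U₀ (u₁ * gaugeExp lam) := by rw [← hveq]; exact hRv
  have hR₂ : Restr129 L (k' + 1) (Λs (k' + 1)) U₀ (u₁ * gaugeExp mu) := by rw [← hweq]; exact hRw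
  -- unitary Λ_j-witnesses for `u₁` (Theorem 4's inductive gauge transformation) at class constant `40d·c_B`, from (1.34), (1.29)
  have hα₃0 : (0 : ℝ) ≤ 40 * d * cB := by positivity
  have hwit : ∀ j, j ≤ k' + 1 → ∀ y ∈ Λs (k' + 1) j, ∃ ut : Site d → 𝔸ˣ, (∀ x, ut x ∈ unitaryUnits 𝔸) ∧
      InLambda L (clampCfg (tlo L y j) (thi L y j) U₀) ut j (40 * d * cB) (((L : ℝ) ^ j)⁻¹) ∧
      ∀ x : Site d, tlo L y j ≤ x → x ≤ thi L y j → u₁ x = ut x := fun j hj y hy =>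
    witness_unitary_of_glev hd1 hL hU₀ hα₀ hα3 hα4 (h33' j hj y hy) hcB0 hsmall hc₃ hsc hα₀ hα3 hαP2 hL1 hBu (h69' j hj y hy) (hP' j hj y hy)
      (glev_on_towers_of_axial hL1 (Λs (k' + 1)) hAx' h129 j hj y hy)
  -- THE UNIQUENESS JOIN AT PRINT'S GENERALITY, GUARDED LEFT INVERSE (`hFP_unique_of_sectE_local_wb`, BY NAME) at `ρ := c_u`, `α₃ := 40d·c_B`
  have heq : lam = mu := hFP_unique_of_sectE_local_wb_src (Ω := Ω) (Λs := Λs (k' + 1)) (f := f)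
    (Eb := fun j => {b : Site d × Fin d | SideTouches (Ω j) b.1 b.2}) (u₁ := u₁) (A := A') hL hη hU₀ hΩ0 hEbΩ hEbT g Δ q qs Aw c g_leftB
    c_left' hΔ hqs hq hq0 H' hα₀ hα3 hα4 hα₃0 hα₄pos hB₀'H hB₂' h33' hwit h129 hH0 hH1 hH2 hQH
    hα₃' hs₁ hs₂ hs₃ hs₄ hs₅ hs₆ hs₇ hsm hprod8 hE_def hE₂_def lE_def lE₂_def hBG hBR hcA0 hcA' hcDA0 ha₁' hb₁' hθ hlE hcu hG hRbd hDA hmf hf hAd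
    h103 h106 hl₁ hD₁ hmult₁ hR₁ hl₂ hD₂ hmult₂ hR₂
  intro x
  rw [hveq, hweq, heq]

end Literature.MathematicalPhysics.QuantumFieldTheory.Balaban1983to89.B8SockP5uEAssemblyBSrc

end
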